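import Summits.BirchSwinnertonDyer.BirchSwinnertonDyer.Theorems.PrintX10bBeyondCarrierOfTenPrintLeavesProp141
import Literature.NumberTheory.EllipticCurves.CastellaGrossiSkinner2025.HeegnerKolyvaginBoundAnyClassNumberProofs
import HarnessLib

/-!
# Crux `BeyondCarrierDepthX10b` (stmt-BirchSwinnertonDyer-23055, PrintX10b aside r301), line «twins» — ROUTE-CURRENCY
# ACCOUNTING of census v4: the crux BY NAME from four of the route's five open `closes` binders plus ONE extra print leaf

HONEST FRAMING (cell `run/shared/lean/pub/bsd-print-x9/`, seat bsd-line-x10b-p1-w2 g23, width 2 of the registered line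
«twins», skeleton v8 `Cruxes/BeyondCarrierDepthX10b/Lines/twins.lean` sha d9aa95dab226; D-0154 KEY row 10): THEOREMS ONLY,
conditional glue `--supports 23055` (helper); nothing booked, nothing closed, no leaf proved. «beyond-print theorem»: NO.
BSD is not proved by any of this; no summit statement is proved by this seat.

WHAT THIS FILE SAYS.  Census of record v4 (`HowardFrames.beyondCarrierDepthX10b_of_ninePrintLeaves`, bsd-line-x10b-p1 LEAD
g14, p729908) gives the crux from NINE cite-only print facts `hCGLS h57 h59gp h422 h513 h331 hChaL hKo h411`.  Eight of the nine
are literally conjuncts / by-name values of the OPEN `closes` binders of route-BirchSwinnertonDyer-PrintX10b (rev 55), and the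
ninth (`hCGLS`, CGLS 2022 Thm. 4.1.3) is the kernel consequence `CastellaGrossiSkinner2025.thm413_of_thm652_stabilized` of the
binder `CGSHowardDivisibilityPLocalized` (CGS 2025 Thm. 6.5.2, stmt-27112):
* `h411` = `Theses.PrintX10b.CGLSHeegnerKolyvaginSystem` (stmt-23236, F-411) by definition;
* `hCGLS` ⟸ `Theses.PrintX10b.CGSHowardDivisibilityPLocalized` (stmt-27112) by `thm413_of_thm652_stabilized` (p611920);
* `h57`, `h59gp`, `h422`, `h513` = conjuncts 1–4 of `Theses.PrintX10b.PinnedTransferPrintFacts` (stmt-26358);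
* `hKo`, `h331` = conjuncts 2 and 8 of `Theses.PrintX10b.HeegnerPrintFactsX10b` (stmt-21206);
* `hChaL` = `Cha2005.rmk25_pow_dvd_card_sha_primary_of_certificate` (Kolyvagin's structure theorem under irreducibility,
  LOWER half, Cha 2005 Thm. 21 / Rmk. 25) — the ONE print input of the crux that is NOT in the route's trust base (the route
  carries only the UPPER half `rmk25_padicValNat_card_sha_primary_add_le_of_globalDivisibility`, conjunct 5 of
  `HeegnerPrintFactsX10b` / item `ChaStructureUpperHalf`).
Hence **`beyondCarrierDepthX10b_of_routeBinders_of_chaLower (hK hCGS hPT hHP hChaL) : BeyondCarrierDepthX10b`**: the aside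
crux 23055 is closed in the kernel modulo four of the five open `closes` binders of its own route (`hK hCGS hPT hHP`; the fifth,
`PrintFactsX10b`, is not used) and exactly one further cite-only print fact, Cha 2005 Rmk. 25 (lower half).  This is an
ACCOUNTING corollary of census v4 in the route's own currency (x10b-p1-w8 g15's remark «nine facts ⊆ closure of
{hK, hCGS, hPT, hHP} ∪ {Cha Rmk 25 LOWER half}» made a kernel statement); it does not change the census of record, the leaf
count, or any booking.  What is NOT proved: any binder, any leaf, the crux unconditionally, BSD.

References: [CastellaGrossiSkinner2025] Thm. 6.5.2 with Thm. 6.5.1; [CastellaGrossiLeeSkinner2022] Thm. 4.1.1, 4.1.3, 5.1.3;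
[YanZhu2024MainConjNonCM] Thm. 5.7 (1), 5.9; [BurungaleCastellaSkinner2025] Prop. 4.2.2; [JetchevSkinnerWan2017] Thm. 3.3.1;
[Cha2005] Thm. 21, Rmk. 25; [Kolyvagin1990] Thm. A; [Howard2004HeegnerKolyvagin] Prop. 1.4.1, Thm. 1.4.2, Thm. 1.6.1.
-/

-- the REGISTERED stub namespace `Summit.BirchSwinnertonDyer.BirchSwinnertonDyer.Cruxes.…` repeats the summit name
set_option linter.dupNamespace false
set_option autoImplicit false

noncomputable section

open Literature.NumberTheory.EllipticCurves
open Summit.BirchSwinnertonDyer.BirchSwinnertonDyer.Theses.PrintX10b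
  (BeyondCarrierDepthX10b CGLSHeegnerKolyvaginSystem CGSHowardDivisibilityPLocalized PinnedTransferPrintFacts
    HeegnerPrintFactsX10b)

namespace Summit.BirchSwinnertonDyer.BirchSwinnertonDyer.Cruxes.BeyondCarrierDepthX10b.HowardFrames

/-- **ROUTE-CURRENCY ACCOUNTING of census v4 — crux `BeyondCarrierDepthX10b` (stmt-BirchSwinnertonDyer-23055) BY NAME from
four OPEN `closes` binders of route-BirchSwinnertonDyer-PrintX10b and ONE further cite-only print fact.**  Granted
`hK : CGLSHeegnerKolyvaginSystem` (stmt-23236 = CGLS 2022 Thm. 4.1.1 KS-form, F-411), `hCGS : CGSHowardDivisibilityPLocalized`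
(stmt-27112 = CGS 2025 Thm. 6.5.2), `hPT : PinnedTransferPrintFacts` (stmt-26358: YZ Thm. 5.7 (1) ∧ the pinned transfer ∧
BCS Prop. 4.2.2 ∧ CGLS Thm. 5.1.3 ∧ Carayol), `hHP : HeegnerPrintFactsX10b` (stmt-21206; used: conjunct 2 = Kolyvagin Thm. A
∀-schema and conjunct 8 = JSW Thm. 3.3.1) and `hChaL : Cha2005.rmk25_pow_dvd_card_sha_primary_of_certificate` (Cha 2005
Thm. 21 / Rmk. 25, LOWER half of Kolyvagin's structure theorem under irreducibility — NOT among the route's binders), the crux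
holds: census v4 `beyondCarrierDepthX10b_of_ninePrintLeaves` fed with `thm413_of_thm652_stabilized hCGS` (CGLS 4.1.3 from
CGS 6.5.2, kernel) and the projections of `hPT` / `hHP`.  The fifth `closes` binder `PrintFactsX10b` is not used.
CONDITIONAL on five cite-only print inputs; credits nothing; changes no census / booking; no summit statement is proved here;
BSD is not proved by this.
[cite: CastellaGrossiSkinner2025, Thm. 6.5.2] [cite: CastellaGrossiLeeSkinner2022, Thm. 4.1.1, Thm. 4.1.3 and Thm. 5.1.3]
[cite: YanZhu2024MainConjNonCM, Thm. 5.7 (1), 5.9] [cite: BurungaleCastellaSkinner2025, Prop. 4.2.2]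
[cite: JetchevSkinnerWan2017, Thm. 3.3.1] [cite: Cha2005, Thm. 21 and Rmk. 25] [cite: Kolyvagin1990, Thm. A]
[cite: Howard2004HeegnerKolyvagin, Prop. 1.4.1, Thm. 1.4.2 and Thm. 1.6.1] -/
theorem beyondCarrierDepthX10b_of_routeBinders_of_chaLower
    (hK : CGLSHeegnerKolyvaginSystem) (hCGS : CGSHowardDivisibilityPLocalized)
    (hPT : PinnedTransferPrintFacts) (hHP : HeegnerPrintFactsX10b)
    (hChaL : Cha2005.rmk25_pow_dvd_card_sha_primary_of_certificate) :
    BeyondCarrierDepthX10b := by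
  have h652 : CastellaGrossiSkinner2025.thm652_stabilized_rankOne_charIdeal_torsion_dvd_pLocalized.{0} := hCGS
  obtain ⟨h57, h59gp, h422, h513, _hC⟩ := hPT
  exact beyondCarrierDepthX10b_of_ninePrintLeaves (CastellaGrossiSkinner2025.thm413_of_thm652_stabilized h652)
    h57 h59gp h422 h513 hHP.2.2.2.2.2.2.2.1 hChaL hHP.2.1 hK

end Summit.BirchSwinnertonDyer.BirchSwinnertonDyer.Cruxes.BeyondCarrierDepthX10b.HowardFrames

end
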